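/-
COR-CM (cells pub-hodgecm / pub-hodgecm2, Hodge ladder stage 2) — TRANSPOSITION item (vi), sub-binder S2 `supply`
(hodge-director/ITEM6-SPLIT.md §(c)/§5): (C6b*), the CM side of the object match, COMPOSED — the CM-side reach transfer
(`CorCM/CMSideReachTransfer.lean`, p279849) at the Galois identity of the inverse type (`CorCM/InverseTypeReflexSubpair.lean`,
p280957).  Written by the stage-1 binder seat pub-hodgecm-mc-binder-1 (gen 21, prover-pub-hodgecm-mc-binder-1-g21-0) in its own
count-neutral lane (theorems only; nothing under `CorCM/B01/` edited or restated).  HC_CM is NOT proved.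
-/
import Summits.HodgeConjecture.CorCM.CMSideReachTransfer
import Summits.HodgeConjecture.CorCM.InverseTypeReflexSubpair
import Summits.HodgeConjecture.CorCM.Model.CMProdBiproduct
import HarnessLib

/-!
# (C6b*) composed: a CM abelian variety of reflex type for `Φ^{*ι₁}` reaches `A_{(F,Φ)}`

For a Galois CM field `F : CMField`, `ι₁ : F → ℂ`, CM types `Φ, Θ` of `F` inverse through `ι₁`
(`ι₁ ∘ g ∈ Θ ↔ ι₁ ∘ g⁻¹ ∈ Φ`, i.e. `Θ = Φ^{*ι₁} = Transposition.invType ι₁ Φ`), the reflex pair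
`(K*, Θ*) = (reflexField ℚ F (algValuedIn ι₁ Θ), reflexCMType ι₁ Θ id)` of `Θ`, a CM field `M` with a ring map `e : K* → M`,
and ANY complex abelian variety `B` realising on `H¹` the type of `M` induced from `Θ*` along `e`
(`IsCMTypeRealisation (inducedCMType e Θ*) B ι_B θ_B` — the shape [Liu2021] Def. 4.3 (2) / Def. 4.5 (2) gives `A_μ ⊗_{E,ι₁} ℂ`
over `M = M_μ` for a weight-one character `μ` of type `Φ_μ = Θ`, once Liu's reflex field `M'_μ` is identified with `K*`:
tree `Liu2021.LiuCMData.cmType_eq_induced_of_det45`):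

* `Model.exists_hom_cmAV_ne_zero_of_isInverse_reflex` — every non-zero `u : X ⟶ B` (e.g. `X = Alb(P_Γ(V))`) yields a non-zero
  `X ⟶ A_{(F,Φ)} = (cmRealisation h₃ (cmCode F Φ)).AV`;
* `Model.exists_hom_cmAV_ne_zero_self_of_isInverse_reflex` — in particular `Hom(B, A_{(F,Φ)}) ≠ 0` ((C6b*) as worded in
  b01-idea-1 `HOME/b01/IDEA-1l-inverse-type-c6b.md` §2 and item6-p1 `S2-ASPRINTED-CHAIN.md` (C6b*)).
* `Model.exists_hom_cmAV_ne_zero_of_forall_mem_iff₂` — membership form on both sides (plugs `LiuCMData.mem_cmType_iff_of_det45`).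
* Design (β) conveniences (b01-idea-1 IDEA-1m, record-valued `D`): `Model.isCMTypeRealisation_cmCode_read`,
  `Model.exists_hom_cmAV_ne_zero_of_reach_cmCode_reflex` (target `Amu := (cmRealisation h₃ (cmCode M ((Θ*)^M))).AV`, no
  realisation hypothesis), `Model.exists_ne_zero_of_tmul_ne_zero` (`ℚ ⊗ Hom ∋ x ≠ 0 ⇒ Hom ∋ u ≠ 0`).
* For the SHIMURA side (C6a, item6-p1 MATCH-SPLIT «`A_K ⊗_{E,ι₁} ℂ ≅ ∏_i Alb(P_{Γ_i}(V))`»), the one categorical step it needs: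
  `CMReach.exists_inj_comp_ne_zero` — a non-zero homomorphism OUT OF a finite categorical product `∏_j X_j` of complex abelian
  varieties restricts non-trivially to some factor (along a section `s_j` of `π_j`), and `CMReach.exists_comp_ne_zero_of_iso_prod`
  — the same behind an isomorphism `A ≅ ∏_j X_j`.  (Preadditive: the limit fan is a bilimit bicone, `∑ π_j ≫ ι_j = 𝟙`, Mathlib
  `biconeIsBilimitOfLimitConeOfIsLimit` / `IsBilimit.total`.)

So on the CM side of the S2 junction's `hMatch` the only non-kernel input left is the IDENTIFICATION of Liu's abstract reflex
data `(M'_μ, Ψ_μ)` (`LiuCMData.M'`, the reflex-norm set `S`) with the tree's reflex pair `(K*, Θ*)` — a field isomorphism plus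
`S = Θ*`, i.e. construction data of the datum, not a statement about abelian varieties; the Shimura-side match (C0/C6a) is untouched.

References: G. Shimura, *Abelian Varieties with Complex Multiplication and Modular Functions* (1998) §6.1 Cor. of Thm. 2, §6.2
Thm. 3, §8.3 Prop. 28; Y. Liu, Camb. J. Math. 9 (2021) Def. 4.3 (2), Def. 4.5 (2), Thm. 4.18 (1).
-/

noncomputable section

open CategoryTheory NumberField
open Literature.AlgebraicGeometry.Motives
open Literature.AlgebraicGeometry.HodgeTheory (complexBetti)
open Literature.AlgebraicGeometry.ComplexMultiplication
open Literature.NumberTheory.ComplexMultiplication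
open Literature.NumberTheory.Automorphic.PicardCM (cmRealisation CMAbelianVarietyRealised)

namespace Summit.HodgeConjecture.CorCM.CMReach

open CategoryTheory.Limits

/-! ## Non-zero homomorphisms OUT OF a finite product (for the Shimura-side match C6a) -/

/-- **A non-zero homomorphism out of a finite categorical product of complex abelian varieties is non-zero on some factor**:
if `(P, π_j)_j` is a limit fan of `X : J → AbelianVariety ℂ` (`J` finite) and `w : P ⟶ B` is non-zero, there are `j` and a
SECTION `s : X j ⟶ P` of `π_j` (`s ≫ π_j = 𝟙`) with `s ≫ w ≠ 0` — in the preadditive category `AbelianVariety ℂ` the fan is a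
bilimit bicone with `∑_j π_j ≫ ι_j = 𝟙_P` (Mathlib `biconeIsBilimitOfLimitConeOfIsLimit`, `IsBilimit.total`), so
`w = ∑_j π_j ≫ (ι_j ≫ w)`. [cite: MumfordAV1970, §19 Thm. 1 Cor. 1 (p. 173)] -/
theorem exists_inj_comp_ne_zero {J : Type} [Fintype J] [DecidableEq J] {X : J → AbelianVariety ℂ} {P B : AbelianVariety ℂ}
    {π : (j : J) → (P ⟶ X j)} (hlim : IsLimit (Fan.mk P π)) {w : P ⟶ B} (hw : w ≠ 0) :
    ∃ (j : J) (s : X j ⟶ P), s ≫ π j = 𝟙 (X j) ∧ s ≫ w ≠ 0 := by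
  classical
  let b : Bicone X := Bicone.ofLimitCone hlim
  have hb : b.IsBilimit := biconeIsBilimitOfLimitConeOfIsLimit hlim
  -- read the bicone on `P` (its point is `P` and its projections are the `π j`, definitionally)
  let ι' : (j : J) → (X j ⟶ P) := fun j => b.ι j
  have hsec : ∀ j, ι' j ≫ π j = 𝟙 (X j) := fun j => bicone_ι_π_self b j
  have htot : ∑ j, π j ≫ ι' j = 𝟙 P := IsBilimit.total hb
  by_contra hall
  push Not at hall
  apply hw
  calc w = (∑ j, π j ≫ ι' j) ≫ w := by rw [htot, Category.id_comp]
    _ = ∑ j, π j ≫ (ι' j ≫ w) := by rw [Preadditive.sum_comp]; simp only [Category.assoc]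
    _ = 0 := Finset.sum_eq_zero fun j _ => by rw [hall j (ι' j) (hsec j), comp_zero]

/-- **… and behind an isomorphism `A ≅ ∏_j X_j`**: a non-zero `w : A ⟶ B` gives, for some factor, a non-zero `X j ⟶ B`
(compose a section of `π_j` with `e.inv`). [cite: MumfordAV1970, §19 Thm. 1 Cor. 1 (p. 173)] -/
theorem exists_comp_ne_zero_of_iso_prod {J : Type} [Fintype J] [DecidableEq J] {X : J → AbelianVariety ℂ}
    {P A B : AbelianVariety ℂ} {π : (j : J) → (P ⟶ X j)} (hlim : IsLimit (Fan.mk P π)) (e : A ≅ P)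
    {w : A ⟶ B} (hw : w ≠ 0) : ∃ (j : J) (v : X j ⟶ B), v ≠ 0 := by
  have hw' : e.inv ≫ w ≠ 0 := fun h => hw (by
    rw [← Category.id_comp w, ← e.hom_inv_id, Category.assoc, h, comp_zero])
  obtain ⟨j, s, -, hs⟩ := exists_inj_comp_ne_zero hlim hw'
  exact ⟨j, s ≫ e.inv ≫ w, by rwa [← Category.assoc] at *⟩

end Summit.HodgeConjecture.CorCM.CMReach

namespace Summit.HodgeConjecture.CorCM.Model

open CMReach

variable {M : Type} [Field M] [NumberField M] [IsCMField M]

/-- **(C6b*) composed.**  `F` Galois CM, `Θ = Φ^{*ι₁}` (inverse through `ι₁`), `(K*, Θ*)` the reflex pair of `Θ`, `e : K* → M`,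
`B` a realisation of `(M; (Θ*)^M)`: every non-zero `u : X ⟶ B` gives a non-zero `X ⟶ A_{(F,Φ)}` — `CorCM/CMSideReachTransfer`'s
`exists_hom_cmAV_ne_zero_of_forall_mem_iff` at `K₀ := K*` (a CM field, `isCMField_reflexField_algValuedIn`), `k := (K* ⊆ F)`,
`Φ₀ := Θ*`, whose hypothesis `∀ τ, τ ∈ Φ ↔ τ|_{K*} ∈ Θ*` is `CorCM/InverseTypeReflexSubpair`'s
`forall_mem_iff_comp_val_mem_reflexCMType_of_isInverse`.
[cite: Shimura1998, §6.2 Theorem 3, §6.1 Corollary of Theorem 2 and §8.3 Prop. 28] [cite: Liu2021, Def. 4.5 (2)] -/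
theorem exists_hom_cmAV_ne_zero_of_isInverse_reflex (h₃ : CMAbelianVarietyRealised)
    (F : CMField) [IsGalois ℚ F] (ι₁ : F →+* ℂ) {Φ Θ : CMType F}
    (hΘ : ∀ g : F ≃ₐ[ℚ] F, ι₁.comp (g : F →+* F) ∈ Θ.1 ↔ ι₁.comp (g.symm : F →+* F) ∈ Φ.1)
    (e : reflexField ℚ F (algValuedIn ι₁ Θ.1) →+* M)
    {B : AbelianVariety ℂ} {ιB : 𝓞 M →+* End B} {θB : M →+* Module.End ℂ (complexBetti B.X 1)}
    (hB : IsCMTypeRealisation (inducedCMType e (reflexCMType ι₁ Θ (AlgHom.id ℚ F))) B ιB θB)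
    {X : AbelianVariety ℂ} {u : X ⟶ B} (hu : u ≠ 0) :
    ∃ v : X ⟶ (cmRealisation h₃ (cmCode F Φ)).AV, v ≠ 0 := by
  haveI : IsCMField (reflexField ℚ F (algValuedIn ι₁ Θ.1)) := isCMField_reflexField_algValuedIn ι₁ Θ
  exact exists_hom_cmAV_ne_zero_of_forall_mem_iff h₃ (reflexCMType ι₁ Θ (AlgHom.id ℚ F)) e hB F
    ((reflexField ℚ F (algValuedIn ι₁ Θ.1)).val : reflexField ℚ F (algValuedIn ι₁ Θ.1) →+* F) Φ
    (forall_mem_iff_comp_val_mem_reflexCMType_of_isInverse ι₁ hΘ) hu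

/-- **(C6b*) as worded**: `Hom(B, A_{(F,Φ)}) ≠ 0` for every realisation `B` of a type induced from the reflex pair of
`Θ = Φ^{*ι₁}` (with `B = A_μ ⊗_{E,ι₁} ℂ`, `Φ_μ = Φ^{*ι₁}`: «`A_μ ⊗_{E,ι₁} ℂ` and the realised `A_{(F,Φ)}` share non-zero
homomorphisms»).  `X = B`, `u = 𝟙 B ≠ 0` (`id_ne_zero_of_isCMTypeRealisation`).
[cite: Shimura1998, §6.2 Theorem 3, §6.1 Corollary of Theorem 2 and §8.3 Prop. 28] [cite: Liu2021, Def. 4.5 (2)] -/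
theorem exists_hom_cmAV_ne_zero_self_of_isInverse_reflex (h₃ : CMAbelianVarietyRealised)
    (F : CMField) [IsGalois ℚ F] (ι₁ : F →+* ℂ) {Φ Θ : CMType F}
    (hΘ : ∀ g : F ≃ₐ[ℚ] F, ι₁.comp (g : F →+* F) ∈ Θ.1 ↔ ι₁.comp (g.symm : F →+* F) ∈ Φ.1)
    (e : reflexField ℚ F (algValuedIn ι₁ Θ.1) →+* M)
    {B : AbelianVariety ℂ} {ιB : 𝓞 M →+* End B} {θB : M →+* Module.End ℂ (complexBetti B.X 1)}
    (hB : IsCMTypeRealisation (inducedCMType e (reflexCMType ι₁ Θ (AlgHom.id ℚ F))) B ιB θB) :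
    ∃ v : B ⟶ (cmRealisation h₃ (cmCode F Φ)).AV, v ≠ 0 :=
  exists_hom_cmAV_ne_zero_of_isInverse_reflex h₃ F ι₁ hΘ e hB (id_ne_zero_of_isCMTypeRealisation hB)

/-- **Membership form on BOTH sides** (to plug [Liu2021] Def. 4.5 (2) directly: tree
`LiuCMData.mem_cmType_iff_of_det45 : θ ∈ Θ ↔ θ.comp (algebraMap M'_μ M_μ) ∈ S`): if the type `ΘB` realised by `B` over `M`
satisfies `θ ∈ ΘB ↔ θ ∘ e ∈ Φ₀` and the target type satisfies `τ ∈ Φ ↔ τ ∘ k ∈ Φ₀`, every non-zero `u : X ⟶ B` gives a non-zero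
`X ⟶ A_{(F,Φ)}`. [cite: Shimura1998, §6.2 Theorem 3 and §6.1 Corollary of Theorem 2 (pp. 41–43)] [cite: Liu2021, Def. 4.5 (2)] -/
theorem exists_hom_cmAV_ne_zero_of_forall_mem_iff₂ (h₃ : CMAbelianVarietyRealised)
    {K₀ : Type} [Field K₀] [NumberField K₀] [IsCMField K₀] (Φ₀ : CMType K₀) (e : K₀ →+* M)
    (ΘB : CMType M) (hΘB : ∀ θ : M →+* ℂ, θ ∈ ΘB.1 ↔ θ.comp e ∈ Φ₀.1)
    {B : AbelianVariety ℂ} {ιB : 𝓞 M →+* End B} {θB : M →+* Module.End ℂ (complexBetti B.X 1)}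
    (hB : IsCMTypeRealisation ΘB B ιB θB)
    (F : CMField) (k : K₀ →+* F) (Φ : CMType F) (hΦ : ∀ τ : F →+* ℂ, τ ∈ Φ.1 ↔ τ.comp k ∈ Φ₀.1)
    {X : AbelianVariety ℂ} {u : X ⟶ B} (hu : u ≠ 0) :
    ∃ v : X ⟶ (cmRealisation h₃ (cmCode F Φ)).AV, v ≠ 0 := by
  have hΘeq : ΘB = inducedCMType e Φ₀ :=
    Subtype.ext (Set.ext fun θ => (hΘB θ).trans (mem_inducedCMType_iff e Φ₀ θ).symm)
  subst hΘeq
  exact exists_hom_cmAV_ne_zero_of_forall_mem_iff h₃ Φ₀ e hB F k Φ hΦ hu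

/-! ## Conveniences for the RECORD-VALUED design (β) of b01-idea-1 IDEA-1m (`Amu := (cmRealisation h₃ (cmCode M Ψ̃)).AV`,
`HomK K Dμ := ⊕_j ℚ ⊗ Hom(𝒥_j.J, Amu)`) -/

/-- **The chosen realisation of `cmCode K Ψ`, READ OVER the bundled CM field `K`**, realises `(K; Ψ)` (the `Model`-namespace
form of `Domination.isCMTypeRealisation_cmCode`: the two `cmCode`s agree definitionally). [cite: Shimura1998, §5.2 and §6.2 Theorem 3] -/
theorem isCMTypeRealisation_cmCode_read (h₃ : CMAbelianVarietyRealised) (K : CMField) (Ψ : CMType K) :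
    IsCMTypeRealisation Ψ (cmRealisation h₃ (cmCode K Ψ)).AV
      ((cmRealisation h₃ (cmCode K Ψ)).ι.comp (RingOfIntegers.mapRingEquiv (cmCodeEquiv K Ψ)).toRingHom)
      ((cmRealisation h₃ (cmCode K Ψ)).θ.comp (cmCodeEquiv K Ψ).toRingHom) :=
  Domination.isCMTypeRealisation_cmCode K h₃ Ψ

/-- **Design (β), CM side, turnkey**: with `Amu := (cmRealisation h₃ (cmCode M Ψ̃)).AV` the tree's OWN realisation of the type
`Ψ̃ = (Θ*)^M` of a CM field `M` (`M = M_μ`) induced along `e : K* → M` from the reflex CM type `Θ*` of `Θ = Φ^{*ι₁}`, every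
non-zero `u : X ⟶ Amu` gives a non-zero `X ⟶ A_{(F,Φ)}` — no realisation hypothesis left.
[cite: Shimura1998, §6.2 Theorem 3, §6.1 Corollary of Theorem 2 and §8.3 Prop. 28] [cite: Liu2021, Def. 4.5 (2)] -/
theorem exists_hom_cmAV_ne_zero_of_reach_cmCode_reflex (h₃ : CMAbelianVarietyRealised)
    (F : CMField) [IsGalois ℚ F] (ι₁ : F →+* ℂ) {Φ Θ : CMType F}
    (hΘ : ∀ g : F ≃ₐ[ℚ] F, ι₁.comp (g : F →+* F) ∈ Θ.1 ↔ ι₁.comp (g.symm : F →+* F) ∈ Φ.1)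
    (M : CMField) (e : reflexField ℚ F (algValuedIn ι₁ Θ.1) →+* M)
    {X : AbelianVariety ℂ}
    {u : X ⟶ (cmRealisation h₃ (cmCode M (inducedCMType e (reflexCMType ι₁ Θ (AlgHom.id ℚ F))))).AV} (hu : u ≠ 0) :
    ∃ v : X ⟶ (cmRealisation h₃ (cmCode F Φ)).AV, v ≠ 0 :=
  exists_hom_cmAV_ne_zero_of_isInverse_reflex h₃ F ι₁ hΘ e
    (isCMTypeRealisation_cmCode_read h₃ M (inducedCMType e (reflexCMType ι₁ Θ (AlgHom.id ℚ F)))) hu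

/-- **Coordinates in `ℚ ⊗ Hom`**: a non-zero element of `ℚ ⊗_ℤ A` (e.g. of `Hom⁰ = ℚ ⊗ Hom(𝒥.J, Amu)`) forces a non-zero
element of `A` (if `A = 0` then `ℚ ⊗ A = 0`). [folklore] -/
theorem exists_ne_zero_of_tmul_ne_zero {A : Type} [AddCommGroup A] {x : TensorProduct ℤ ℚ A} (hx : x ≠ 0) :
    ∃ a : A, a ≠ 0 := by
  by_contra hall
  push Not at hall
  apply hx
  induction x using TensorProduct.induction_on with
  | zero => rfl
  | tmul q a => rw [hall a, TensorProduct.tmul_zero]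
  | add y z hy hz =>
      rw [hy (fun h => hx (by simp_all)), hz (fun h => hx (by simp_all)), add_zero]

end Summit.HodgeConjecture.CorCM.Model

end
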